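import Mathlib
import Summits.AtomisticToContinuum.HydrodynamicLimit.Theorems.ImplosionDichotomyDenseExcursionSonicCavityDefs

/-!
# Vocabulary of the line `sonic-cavity-renewal`, part B (skeleton reshape v6 of crux `DenseExcursion`,
# stmt-AtomisticToContinuum-12586): the weighted-`C^k` cavity resolvent and the two halves of `|Im Λ|`-confinement

Definitions file (`--supports stmt-AtomisticToContinuum-12586`, line lead a2). Why a part B (findings of wave 1, recorded in
`Cruxes/DenseExcursion/NOTES-a2.md`):

1. THE WEIGHTED-`C⁰` CAVITY RESOLVENT IS MIS-TYPED. `CavityResolvent` (part A) bounds the weighted sup of the unique smooth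
   centre-regular solution of `(Λ − L)u = F` by the weighted sup of the source. At the repulsive sonic point `x = 0` the
   degenerate characteristic field `p = ŵ + 3ŝ` obeys `λ₊ p′ = (Λ − b)p + …` with `λ₊ = −κx + O(x²)`, a regular-singular point
   with exponents `{0, ν(Λ)}`, `ν(Λ) = (b(0) − Λ)/κ`, `b(0) = 4 − 2r − κ` (landed `sonic_order_zero_coefficient`), and
   `Re ν(Λ) > 0` on the whole strip `−1/5 ≤ Re Λ < b(0) ≈ 1.36`. A positive exponent means the smooth branch is selected by
   `⌈Re ν⌉` jet conditions and the smooth solution operator LOSES `Re ν` DERIVATIVES in sup norm: for sources concentrated at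
   scale `ε` next to the sonic point the ratio solution/source is `∼ ε^{−Re ν}` (scalar model `κ(xu′ − νu) = F`,
   `u_ε = (1 − χ(x/ε))x₊^ν`, `‖F_ε‖_∞ = O(ε^{Re ν})`, `u_ε(1) = 1`). So the `C⁰ → C⁰` bound fails for every admissible profile,
   while the `C^k → C⁰` bound with `k > Re ν` is the classical statement (growth bound `b(0) − kκ` in `C^k`; `k = 4` gives
   `−0.2865` on `SS(r₂)`, the first Evans pole seen by every code of this crux). `CavityResolventCk k` below is `CavityResolvent`
   with the source measured in the weighted `C^k` seminorm `WCkBound k` on the core + margin `x ≤ 1`, everything else verbatim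
   (in particular the uniqueness clause, so the landed `cavityResolvent_unique` serves it unchanged). The skeleton uses `k = 5`:
   on the pinned window `17307/15625 ≤ r ≤ 89409/80000` with `κ ≥ 2/5`, `Re ν ≤ (4.2 − 2r − κ)/κ ≤ 3.962` on `Re Λ ≥ −1/5`,
   so `k = 5` leaves margin `> 1` (constants `∼ 1/(κ(k − Re ν))`).
2. `|Im Λ|`-CONFINEMENT SPLITS INTO A SONIC HALF AND A CENTRE HALF at the matching point `x_m = −7/10`, through the P-WAVE CONTENT
   observable `D = p − ρ m` (`p = ŵ + 3ŝ`, `m = ŵ − 3ŝ`, `ρ = b₊₋/Q` the leading slaving coefficient of the degenerate component to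
   the regular one): `SonicSlaving` (smooth branch at the sonic point ⇒ `|Im Λ|·‖D‖ ≤ 2‖m‖`; measured `‖D‖/‖m‖ = 0.393/|Im Λ|²`)
   and `CentreContent` (centre regularity = acoustic standing wave ⇒ `‖m‖ ≤ 250‖D‖`; measured ratio `≤ 5.3`). For `|Im Λ| > boxTop`
   the two give `D = 0`, `m = 0`, hence `ŵ(x_m) = ŝ(x_m) = 0`, and unique continuation through the sonic point kills the mode
   (assembly `sonicConfinement_of_slaving_of_content`, its own file). The numerals `2`, `250` carry ≥ 40× slack over the values
   measured on `SS(r₂)` for `|Im Λ| ≥ 50`, `−1/4 ≤ Re Λ ≤ 100` (wave-1 worker numerics `dmatch.py`, `ratios.py`); only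
   `2·250 < boxTop = 1000` is consumed.

Contents: `WCkBound`, `CavityResolventCk` (+ monotonicity in `k`), `matchPoint`, `slavingCoeff`, `pWaveContent`, `SonicSlaving`,
`CentreContent`. NOT here: any proof of a stub.
Sources: Coddington–Levinson 1955 Ch. 4 (regular-singular points); Chen–Shkoller–Vicol arXiv:2605.00808 §1.10 (smooth branch at the
repulsive sonic point, loss of derivatives); Coppel 1965 Ch. IV (Levinson); Olver 1974 Ch. 6, 12 (LG at the centre).
-/

noncomputable section

open Filter Set
open scoped Topology ContDiff

namespace Summit.AtomisticToContinuum.HydrodynamicLimit.Theorems.SonicCavityRenewal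

open Summit.AtomisticToContinuum.HydrodynamicLimit.Theorems.R2OneModeTwoConditions

/-! ## The weighted `C^k` cavity resolvent -/

/-- WEIGHTED `C^k` SEMINORM BOUND of a source `(f, g)` on the core + margin `x ≤ 1`: every `x`-derivative of order `j ≤ k`
satisfies `‖f⁽ʲ⁾(y)‖ + e^y ‖g⁽ʲ⁾(y)‖ ≤ N` (weights `1` on the `w`-component, `eˣ` on the `s`-component — the bounded quantities
of a regular pair at the centre; `d/dx = R d/dR` needs no extra centre weight). `k = 0` is the weighted sup of part A. -/
def WCkBound (k : ℕ) (f g : ℝ → ℂ) (N : ℝ) : Prop :=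
  ∀ y : ℝ, y ≤ 1 → ∀ j : ℕ, j ≤ k → ‖iteratedDeriv j f y‖ + Real.exp y * ‖iteratedDeriv j g y‖ ≤ N

/-- A weighted `C^k` bound is a weighted `C^j` bound for every `j ≤ k`. [folklore] -/
theorem WCkBound.mono {k j : ℕ} (hjk : j ≤ k) {f g : ℝ → ℂ} {N : ℝ} (h : WCkBound k f g N) : WCkBound j f g N :=
  fun y hy i hi => h y hy i (hi.trans hjk)

/-- The order-`0` clause of a weighted `C^k` bound is the weighted sup bound of part A. [folklore] -/
theorem WCkBound.sup {k : ℕ} {f g : ℝ → ℂ} {N : ℝ} (h : WCkBound k f g N) :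
    ∀ y, y ≤ 1 → ‖f y‖ + Real.exp y * ‖g y‖ ≤ N := by
  intro y hy
  simpa using h y hy 0 (Nat.zero_le k)

/-- THE WEIGHTED-`C^k` CAVITY RESOLVENT (reshape v6 of `CavityResolvent`): for the package rate `Λ₁` there is ONE constant `C`
such that for every `Λ` in the closed strip `Re Λ ≥ −1/5` outside the `1/20`-discs around `0`, `Λ₁`, `r`, and every smooth
centre-regular source `(f, g)` with weighted `C^k` seminorm `≤ N` on `x ≤ 1`, the resolvent equation `(Λ − L)(ŵ, ŝ) = (f, g)`
has a smooth centre-regular solution on `ℝ`, UNIQUE on `x ≤ 1` among smooth centre-regular solutions, with weighted sup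
`≤ C·N` on `x ≤ 1` — uniformly in `Λ` (loss of `k` derivatives at the repulsive sonic point, none elsewhere; `k > Re ν(Λ)` on the
strip is what makes it true, see the module docstring). Laplace inversion along `Re Λ = −1/5` then gives the time-domain
trichotomy `e^{τL}v₀ = (residues at Λ₁, r, 0) + O_{C⁰_w}(e^{−τ/5}‖v₀‖_{C^{k+2}_w})` inside the heart. -/
def CavityResolventCk (k : ℕ) (r : ℝ) (W S : ℝ → ℝ) : Prop :=
  ∀ Λ₁ : ℝ, 6 * (r - 1) < Λ₁ → Λ₁ < 9 * (r - 1) → (∃ ŵ ŝ : ℝ → ℂ, IsSmoothRadialMode r W S (Λ₁ : ℂ) ŵ ŝ) →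
    ∃ C : ℝ, 0 < C ∧ ∀ Λ : ℂ, -(1 / 5 : ℝ) ≤ Λ.re → (1 / 20 : ℝ) ≤ ‖Λ‖ → (1 / 20 : ℝ) ≤ ‖Λ - (Λ₁ : ℂ)‖ →
      (1 / 20 : ℝ) ≤ ‖Λ - (r : ℂ)‖ →
      ∀ (f g : ℝ → ℂ), IsRegularPair f g → ∀ N : ℝ, WCkBound k f g N →
        ∃ ŵ ŝ : ℝ → ℂ, IsRegularPair ŵ ŝ ∧
          (∀ x, Λ * ŵ x - linW r W S ŵ ŝ x = f x ∧ Λ * ŝ x - linS r W S ŵ ŝ x = g x) ∧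
          (∀ x, x ≤ 1 → ‖ŵ x‖ + Real.exp x * ‖ŝ x‖ ≤ C * N) ∧
          (∀ ŵ' ŝ' : ℝ → ℂ, IsRegularPair ŵ' ŝ' →
            (∀ x, Λ * ŵ' x - linW r W S ŵ' ŝ' x = f x ∧ Λ * ŝ' x - linS r W S ŵ' ŝ' x = g x) →
            ∀ x, x ≤ 1 → ŵ' x = ŵ x ∧ ŝ' x = ŝ x)

/-- Monotonicity in the number of derivatives: measuring the source with MORE derivatives is a weaker demand on the resolvent,
so `CavityResolventCk k → CavityResolventCk k'` for `k ≤ k'`. [folklore] -/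
theorem CavityResolventCk.mono {k k' : ℕ} (hkk' : k ≤ k') {r : ℝ} {W S : ℝ → ℝ} (h : CavityResolventCk k r W S) :
    CavityResolventCk k' r W S := by
  intro Λ₁ h6 h9 hmode
  obtain ⟨C, hC, hres⟩ := h Λ₁ h6 h9 hmode
  refine ⟨C, hC, fun Λ hre h0 h1 hr f g hfg N hN => ?_⟩
  exact hres Λ hre h0 h1 hr f g hfg N (hN.mono hkk')

/-- The mis-typed weighted-`C⁰` resolvent of part A is the case `k = 0` (recorded for the audit trail; part A's statement is
false for every admissible profile, see the module docstring, and is no longer used by the skeleton). [folklore] -/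
theorem cavityResolventCk_zero_iff {r : ℝ} {W S : ℝ → ℝ} : CavityResolventCk 0 r W S ↔ CavityResolvent r W S := by
  have key : ∀ (f g : ℝ → ℂ) (N : ℝ), WCkBound 0 f g N ↔ ∀ y, y ≤ 1 → ‖f y‖ + Real.exp y * ‖g y‖ ≤ N := by
    intro f g N
    refine ⟨fun h => h.sup, fun h y hy j hj => ?_⟩
    obtain rfl : j = 0 := Nat.le_zero.mp hj
    simpa using h y hy
  unfold CavityResolventCk CavityResolvent
  simp only [key]

/-! ## The two halves of `|Im Λ|`-confinement -/

/-- The matching point `x_m = −7/10` in the core (inside the tube's certified region `x ≤ 1`, at distance `0.7` from the sonic point,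
where the singular branch `|x|^ν` of a centre-regular solution is not yet suppressed). -/
def matchPoint : ℝ := -(7 / 10)

/-- THE LEADING SLAVING COEFFICIENT `ρ = b₊₋/Q`, `Q = (Λ − b₊₊) − (c₊/c₋)(Λ − b₋₋)`, of the degenerate characteristic component
`p = ŵ + 3ŝ` to the regular one `m = ŵ − 3ŝ` (`p ≈ ρ m` on the smooth branch; `|Q| ≥ |Im Λ|` on the core), with
`c± = (W − 1) ± S`, `b₊₊ = ⅔W′ + 2W − r + 2S′ + 4S`, `b₊₋ = W′/3 + S′ + 2S`, `b₋₋ = ⅔W′ + 2W − r − 2S′ − 4S`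
(coefficients of `mode_char_system`, landed `…SonicConfinementCharacteristic`). -/
def slavingCoeff (r : ℝ) (W S : ℝ → ℝ) (Λ : ℂ) (x : ℝ) : ℂ :=
  ((deriv W x / 3 + deriv S x + 2 * S x : ℝ) : ℂ) /
    ((Λ - ((2 / 3 * deriv W x + 2 * W x - r + 2 * deriv S x + 4 * S x : ℝ) : ℂ)) -
      (((W x - 1 + S x) / (W x - 1 - S x) : ℝ) : ℂ) *
        (Λ - ((2 / 3 * deriv W x + 2 * W x - r - 2 * deriv S x - 4 * S x : ℝ) : ℂ)))

/-- THE P-WAVE CONTENT OBSERVABLE at the matching point: `D = p − ρ m = (ŵ + 3ŝ) − ρ (ŵ − 3ŝ)` at `x_m`. -/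
def pWaveContent (r : ℝ) (W S : ℝ → ℝ) (Λ : ℂ) (ŵ ŝ : ℝ → ℂ) : ℂ :=
  (ŵ matchPoint + 3 * ŝ matchPoint) - slavingCoeff r W S Λ matchPoint * (ŵ matchPoint - 3 * ŝ matchPoint)

/-- SONIC SLAVING (sonic half of `|Im Λ|`-confinement): for every smooth radial mode in the half-strip `−1/4 < Re Λ ≤ boxSide`
with `|Im Λ| > boxTop`, the p-wave content at `x_m` is slaved: `|Im Λ|·‖D‖ ≤ 2‖m(x_m)‖`. Mechanism: the mode equals the analytic
Frobenius branch at the repulsive sonic point (tube (e); recursion divided by `Λ − b₊₊(0) + nκ`, majorants uniform in `Λ`), slaved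
to second order there, and `levinson_conversion` carries the slaving from `−c/|Λ|` to `x_m` (measured `‖D‖/‖m‖ = 0.393/|Im Λ|²`). -/
def SonicSlaving (r : ℝ) (W S : ℝ → ℝ) : Prop :=
  ∀ (Λ : ℂ) (ŵ ŝ : ℝ → ℂ), IsSmoothRadialMode r W S Λ ŵ ŝ → -(1 / 4 : ℝ) < Λ.re → Λ.re ≤ boxSide → boxTop < |Λ.im| →
    |Λ.im| * ‖pWaveContent r W S Λ ŵ ŝ‖ ≤ 2 * ‖ŵ matchPoint - 3 * ŝ matchPoint‖

/-- CENTRE CONTENT (centre half of `|Im Λ|`-confinement): for the same modes, centre regularity forces comparable amplitudes of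
the two acoustic families at `x_m` (standing wave at the centre: inner problem = regular perturbation of the spherical Bessel
system on `eˣ ≤ C₀/|Λ|`, tube (d); Levinson transport to `x_m`, tube (c)): `‖m(x_m)‖ ≤ 250·‖D‖` (measured ratio `≤ 5.3`,
attained as `Im Λ → ∞` at `Re Λ = −1/4`, decreasing in `Re Λ`). -/
def CentreContent (r : ℝ) (W S : ℝ → ℝ) : Prop :=
  ∀ (Λ : ℂ) (ŵ ŝ : ℝ → ℂ), IsSmoothRadialMode r W S Λ ŵ ŝ → -(1 / 4 : ℝ) < Λ.re → Λ.re ≤ boxSide → boxTop < |Λ.im| →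
    ‖ŵ matchPoint - 3 * ŝ matchPoint‖ ≤ 250 * ‖pWaveContent r W S Λ ŵ ŝ‖

/-- The arithmetic core of the assembly: slaving and content together force the p-wave content and the regular component
to vanish at the matching point once `|Im Λ| > boxTop = 1000 > 2·250`. [folklore] -/
theorem pWaveContent_eq_zero_of_slaving_of_content {r : ℝ} {W S : ℝ → ℝ} {Λ : ℂ} {ŵ ŝ : ℝ → ℂ}
    (hslave : |Λ.im| * ‖pWaveContent r W S Λ ŵ ŝ‖ ≤ 2 * ‖ŵ matchPoint - 3 * ŝ matchPoint‖)
    (hcontent : ‖ŵ matchPoint - 3 * ŝ matchPoint‖ ≤ 250 * ‖pWaveContent r W S Λ ŵ ŝ‖) (him : boxTop < |Λ.im|) :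
    pWaveContent r W S Λ ŵ ŝ = 0 ∧ ŵ matchPoint - 3 * ŝ matchPoint = 0 := by
  have htop : (1000 : ℝ) < |Λ.im| := by simpa [boxTop] using him
  have hD : ‖pWaveContent r W S Λ ŵ ŝ‖ = 0 := by
    by_contra hne
    have hpos : 0 < ‖pWaveContent r W S Λ ŵ ŝ‖ := lt_of_le_of_ne (norm_nonneg _) (Ne.symm hne)
    nlinarith
  have hD' : pWaveContent r W S Λ ŵ ŝ = 0 := norm_eq_zero.mp hD
  refine ⟨hD', ?_⟩
  have hm : ‖ŵ matchPoint - 3 * ŝ matchPoint‖ ≤ 0 := by simpa [hD] using hcontent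
  exact norm_eq_zero.mp (le_antisymm hm (norm_nonneg _))

/-- … and then both components vanish at the matching point: `ŵ(x_m) = ŝ(x_m) = 0` (`p = D + ρ m = 0`, `m = 0`). [folklore] -/
theorem mode_eq_zero_at_matchPoint_of_slaving_of_content : ∀ {r : ℝ} {W S : ℝ → ℝ} {Λ : ℂ} {ŵ ŝ : ℝ → ℂ}, |Λ.im| * ‖pWaveContent r W S Λ ŵ ŝ‖ ≤ 2 * ‖ŵ matchPoint - 3 * ŝ matchPoint‖ → ‖ŵ matchPoint - 3 * ŝ matchPoint‖ ≤ 250 * ‖pWaveContent r W S Λ ŵ ŝ‖ → boxTop < |Λ.im| → ŵ matchPoint = 0 ∧ ŝ matchPoint = 0 := by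
  intro r W S Λ ŵ ŝ hslave hcontent him
  obtain ⟨hD, hm⟩ := pWaveContent_eq_zero_of_slaving_of_content hslave hcontent him
  have hp : ŵ matchPoint + 3 * ŝ matchPoint = 0 := by
    have : pWaveContent r W S Λ ŵ ŝ = (ŵ matchPoint + 3 * ŝ matchPoint) -
        slavingCoeff r W S Λ matchPoint * (ŵ matchPoint - 3 * ŝ matchPoint) := rfl
    rw [this, hm, mul_zero, sub_zero] at hD
    exact hD
  constructor
  · linear_combination (hp + hm) / 2
  · linear_combination (hp - hm) / 6

end Summit.AtomisticToContinuum.HydrodynamicLimit.Theorems.SonicCavityRenewal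

end
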